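import Mathlib
import Summits.ValiantsHypothesis.ValiantsHypothesis.Theorems.NewtonUnitEquationsTwoProductsSeparated

/-! # Rung `stub_engineSeparatedRank` — crux `TwoProducts` (stmt-ValiantsHypothesis-5906), line `corner-log-linearization`

SEPARATED FACTORS OF xy-RANK `c` (lead c7; t-free, crux-shaped for bounded `c`).  If every factor is `Σ_{k<c} B_{ik}(x)·g_{ik}(y)`
with `B_{ik}` supported on the `x`-axis and `g_{ik}` on the `y`-axis, then `∏ u − ∏ v` has at most `2·c^n` south-west vertices:
`∏_i Σ_k B_{ik} g_{ik} = Σ_{κ : [n] → [c]} (∏_i B_{iκ_i})·(∏_i g_{iκ_i})` (`Finset.prod_univ_sum`), so the rows of the difference lie in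
the span of `2c^n` fixed `x`-axis polynomials and the abstract slice-rank count `Separated.ncard_vertices_sub_le` (landed p133405)
applies with index type `Fin n → Fin c`. [folklore] -/

set_option linter.dupNamespace false -- single-conjunct summit: `ValiantsHypothesis.ValiantsHypothesis`

namespace Summit.ValiantsHypothesis.ValiantsHypothesis.Theorems.TwoProducts.SeparatedRank

open scoped BigOperators
open MvPolynomial

/-- A product over a finset of polynomials supported on a coordinate hyperplane `q j = 0` is supported there too. [folklore] -/
theorem prod_support_apply_eq_zero' {n : ℕ} (j : Fin 2) (f : Fin n → MvPolynomial (Fin 2) ℂ)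
    (hf : ∀ i, ∀ q ∈ (f i).support, q j = 0) : ∀ q ∈ (∏ i, f i).support, q j = 0 :=
  Separated.prod_support_apply_eq_zero j Finset.univ f fun i _ => hf i

/-- Distributing a product of sums of separated terms over choice functions. [folklore] -/
theorem prod_sum_mul_eq {n c : ℕ} (B g : Fin n → Fin c → MvPolynomial (Fin 2) ℂ) :
    (∏ i, ∑ k, B i k * g i k) =
      ∑ κ : Fin n → Fin c, (∏ i, B i (κ i)) * ∏ i, g i (κ i) := by
  rw [Finset.prod_univ_sum]
  refine Finset.sum_congr rfl fun κ _ => ?_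
  rw [Finset.prod_mul_distrib]

/-- **RUNG `stub_engineSeparatedRank`** (registered signature): separated factors of xy-rank `c` give at most `2·c^n` south-west
vertices. [folklore] -/
theorem stub_engineSeparatedRank : ∀ (n c : ℕ) (B B' g g' : Fin n → Fin c → MvPolynomial (Fin 2) ℂ),
    (∀ i k, ∀ q ∈ (B i k).support, q 1 = 0) → (∀ i k, ∀ q ∈ (B' i k).support, q 1 = 0) →
    (∀ i k, ∀ q ∈ (g i k).support, q 0 = 0) → (∀ i k, ∀ q ∈ (g' i k).support, q 0 = 0) →
    {e : Fin 2 →₀ ℕ | ∃ w : Fin 2 → ℤ, 0 < w 0 ∧ 0 < w 1 ∧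
        e ∈ ((∏ i, ∑ k, B i k * g i k) - ∏ i, ∑ k, B' i k * g' i k).support ∧
        ∀ e' ∈ ((∏ i, ∑ k, B i k * g i k) - ∏ i, ∑ k, B' i k * g' i k).support, e' ≠ e →
          w 0 * (e 0 : ℤ) + w 1 * (e 1 : ℤ) < w 0 * (e' 0 : ℤ) + w 1 * (e' 1 : ℤ)}.ncard ≤ 2 * c ^ n := by
  intro n c B B' g g' hB hB' hg hg'
  rw [prod_sum_mul_eq B g, prod_sum_mul_eq B' g']
  have h := Separated.ncard_vertices_sub_le (K := ℂ) (ι := Fin n → Fin c)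
    (fun κ => ∏ i, B i (κ i)) (fun κ => ∏ i, g i (κ i)) (fun κ => ∏ i, B' i (κ i)) (fun κ => ∏ i, g' i (κ i))
    (fun κ => prod_support_apply_eq_zero' 1 _ fun i => hB i (κ i))
    (fun κ => prod_support_apply_eq_zero' 0 _ fun i => hg i (κ i))
    (fun κ => prod_support_apply_eq_zero' 1 _ fun i => hB' i (κ i))
    (fun κ => prod_support_apply_eq_zero' 0 _ fun i => hg' i (κ i))
  have hcard : Fintype.card (Fin n → Fin c) = c ^ n := by simp
  rw [hcard] at h
  omega

end Summit.ValiantsHypothesis.ValiantsHypothesis.Theorems.TwoProducts.SeparatedRank
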